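import Literature.AlgebraicGeometry.Motives.SubfamilyContainedInClosedLocus
import HarnessLib

/-!
# The closed layer of the Hom-scheme: «the universal family lies in `W`» is a closed condition (sub-stub (B2) of the II-b child line)

Layer `Literature/AlgebraicGeometry/Morphisms`, namespace `Literature.AlgebraicGeometry.Morphisms`.  THEOREMS ONLY (no `def`, no instance, no
notation, no named fact, no `sorry`); universe `0`.  Cell `hodgecm-mathlib` (D-0151 ∕ FLOOR 0), P1 sub-line F-4 layer 2, II-b child line
`F4IIbHomScheme` (`Cruxes/HDel/Lines/F4IIbHomScheme.lean`), sub-letter **(B2) `stub_IIb4B2_closedLayer`**: the TYPE below is that letter VERBATIM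
and the proof is the instantiation of ★-to-be `Motives/SubfamilyContainedInClosedLocus.exists_idealSheafData_containedIn_iff_of_letters` at
`T := HS`, `i := iH`, `iW := pullback.snd jW 𝐏(h)` (B-p20 (g15); F-4 lead B-p17 (g15) 22:12:21Z names this file).  Count-neutral capital
(`--supports stmt-HodgeConjecture-24835`); HC_CM is proved only modulo the 7 printed citations until rung 0 closes, and nothing here bears on it.

THE PRINT.  [MumfordFogartyKirwan1994] Ch. 0 §5 (c) (p. 23) and [Kollar1996] I Thm. 1.10 (proof): inside the Hilbert scheme `HS` of `𝐏(ι; S)`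
(with universal family `iH : Z_H ↪ 𝐏(ι; HS)`, flat, with the cohomology-and-base-change letters `Q`), the locus of `T`-points `w` whose family
`𝐏(w)^* Z_H` lies inside the fixed closed `W = Y ×_S X ↪ 𝐏(ι; S)` pulled back to `T` is represented by a closed subscheme `V(V) ⊆ HS`.

## References
* [MumfordFogartyKirwan1994] D. Mumford, J. Fogarty, F. Kirwan, *Geometric Invariant Theory*, 3rd ed. (1994), Ch. 0 §5 (c) (p. 23).
* [Kollar1996] J. Kollár, *Rational Curves on Algebraic Varieties* (1996), I Thm. 1.10 (with proof).
-/

noncomputable section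

set_option backward.isDefEq.respectTransparency false

open CategoryTheory CategoryTheory.Limits CategoryTheory.Abelian AlgebraicGeometry Polynomial
open Literature.AlgebraicGeometry
open Literature.AlgebraicGeometry.Modules Literature.AlgebraicGeometry.Modules.SerreTwist
open Literature.Algebra.Homology Literature.Algebra.Homology.LaurentCech

namespace Literature.AlgebraicGeometry.Morphisms

/-- **(B2) The closed layer «the family lies inside `W`»** — the letter `stub_IIb4B2_closedLayer` of the II-b child line `F4IIbHomScheme`, verbatim:
for `jW : Y ×_S X ↪ 𝐏(ι; S)` closed, an admissible `Q`, `h : HS → S` with a closed FLAT family `iH : Z_H ↪ 𝐏(ι; HS)` whose fibres have the letters `Q`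
(`Ext¹ = 0`, `dim H⁰ = Q(e)` for `e ≥ B(Q) − 1`), there is an ideal sheaf `V` on `HS` such that `w : T → HS` (`T` locally Noetherian) kills `V` iff
`𝓘_{W_{HS}} · 𝒪_{𝐏(ι;T)} ≤ 𝓘_{Z_H} · 𝒪_{𝐏(ι;T)}` along `𝐏(w)`.  Proof: ★-to-be `Motives.exists_idealSheafData_containedIn_iff_of_letters` at `T := HS`,
`i := iH`, `iW := pullback.snd jW 𝐏(h)`. [cite: MumfordFogartyKirwan1994, Ch. 0 §5 (c) (p. 23)] [cite: Kollar1996, I Thm. 1.10 (proof)] -/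
theorem exists_idealSheafData_homSchemeClosedLayer : ∀ ⦃S Y X : Scheme.{0}⦄ [IsLocallyNoetherian S] (q : Y ⟶ S) (p : X ⟶ S) {ι : Type}
    (_ : 1 ≤ Nat.card ι) (jW : pullback q p ⟶ Morphisms.projectiveSpace ι S) [IsClosedImmersion jW] (Q : ℚ[X])
    (_ : ∀ e : ℕ, regularityBound (preHilbertPoly ℚ (Nat.card ι) 0) 0 (preHilbertPoly ℚ (Nat.card ι) 0 - Q) - 1 ≤ (e : ℤ) →
      ((⌊Q.eval (e : ℚ)⌋₊ : ℕ) : ℚ) = Q.eval (e : ℚ))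
    ⦃HS : Scheme.{0}⦄ [IsLocallyNoetherian HS] (h : HS ⟶ S) ⦃ZH : Scheme.{0}⦄ (iH : ZH ⟶ Morphisms.projectiveSpace ι HS)
    [IsClosedImmersion iH] [Flat (iH ≫ Morphisms.projectiveSpaceFst ι HS)],
    -- the universal family has the letters `Q` (so `(p_Z)_*𝒪(e)` is locally free with base change, as the 2A letter wants)
    (∀ ⦃K : Type⦄ [Field K] ⦃X₀ : Scheme.{0}⦄ (k : X₀ ⟶ ZH) (f₀ : X₀ ⟶ Spec (CommRingCat.of K))
      (x : Spec (CommRingCat.of K) ⟶ HS), IsPullback k f₀ (iH ≫ Morphisms.projectiveSpaceFst ι HS) x →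
      ∀ e : ℕ, regularityBound (preHilbertPoly ℚ (Nat.card ι) 0) 0 (preHilbertPoly ℚ (Nat.card ι) 0 - Q) - 1 ≤ (e : ℤ) →
        Subsingleton (CategoryTheory.Abelian.Ext.{1} (unitModule X₀) ((Scheme.Modules.pullback k).obj
          (twistMod (iH ≫ pullback.snd (terminal.from HS) (terminal.from (Morphisms.projectiveSpaceInt ι))) (unitModule _) e)) 1) ∧
        ((Module.finrank Γ(Spec (CommRingCat.of K), ⊤) (SecMod ((Scheme.Modules.pullback k).obj
          (twistMod (iH ≫ pullback.snd (terminal.from HS) (terminal.from (Morphisms.projectiveSpaceInt ι))) (unitModule _) e))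
          f₀.appTop.hom ⊤) : ℕ) : ℚ) = Q.eval (e : ℚ)) →
    ∃ V : HS.IdealSheafData, ∀ ⦃T : Scheme.{0}⦄ [IsLocallyNoetherian T] (w : T ⟶ HS),
      V ≤ w.ker ↔
        (pullback.snd jW (Morphisms.projectiveSpaceMap ι h)).ker.comap (Morphisms.projectiveSpaceMap ι w) ≤
          iH.ker.comap (Morphisms.projectiveSpaceMap ι w) := by
  intro S Y X _ q p ι _ jW _ Q hQ HS _ h ZH iH _ _ hL
  obtain ⟨V, hV⟩ := Motives.exists_idealSheafData_containedIn_iff_of_letters iH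
    (pullback.snd jW (Morphisms.projectiveSpaceMap ι h)) Q hQ hL
  exact ⟨V, fun T _ w => hV w⟩

end Literature.AlgebraicGeometry.Morphisms

end
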